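import Summits.QuantumFields.BalabanUV.T4Continuum.Support.NE7AxialChartTorus
import HarnessLib

/-!
# NE7 — A LOCAL CHART ON A CUBE, AS [B11] Thm 1 (9) PRINTS IT, PERIODISED INTO THE `hchart` BINDER OF THE WIDE CHAIN (F297)

Cell `pub-balaban`, rung (B)+1 sub-cell t4, lineage `b2b-balaban-t4-ne7-p1` (CRUX PROVER NE7 #1 = OWNER of row NE7), generation 92; memo
`t4/b2b-balaban-t4-ne7-p1-g92/LOG-OBSTRUCTION.md` §3.  Over F290a `NE7AxialChartCube` (the cut-off profile) and F290b `NE7AxialChartTorus` (the centred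
representative); this file is their ABSTRACT form: the chart is a HYPOTHESIS of the printed shape, not the axial gauge.

WHY.  [Balaban1985Variational] Thm 1 (9) p. 279 gives, for a minimal configuration `U` and a cube `□` of `M_c` blocks, «a gauge transformation `u` defined on a
neighborhood of `□` and such that on `□`, `U^{u⁻¹} = e^{iηA}`, `|A| < B₃M_cε₁(L^jη)^{−1}`, `|∇^ηA| < B₃M_cε₁(L^jη)^{−2}`» — a LOCAL gauge and a LOCAL potential with the
sup and gradient letters ON THE CUBE.  The wide chain's chart binder (F285w `NE7HintOfLocalChartWide` ∕ F286w `NE7HintOfLocalChartSU2Wide`, `hchart`) asks instead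
for a PERIODIC unitary site gauge on the cover torus and a PERIODIC skew field `At` with GLOBAL letters `a₀`, `a₁`, agreeing with `U^{u}` on a torus ball.  This file is
the kinematic bridge: a cube chart (unitary `u₀`, skew `A₀`, `U^{u₀} = e^{A₀}` and `‖A₀‖ ≤ b₀`, `‖∇A₀‖ ≤ b₁` on the sup-cube of radius `R′` about `z`) on a `P`-periodic
`U` with `2R′ + 4 ≤ P` yields the seven-clause periodic chart with letters `b₀` and `b₁ + b₀∕M_w` and agreement on the torus ball of radius `R′ − M_w` (cut-off of width
`M_w`, then the centred representative `c(y) = z − h𝟙 + ((y − z + h𝟙) mod P)`, `h = R′ + 1`).  Gen 92 uses it to state the NE7-specific input of route 1's END in the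
printed FIRST-ORDER form (F298 `NE7HintOfCubeChartSU2`): the plaquette-gradient ∕ second-difference forms of gen 91 ((PG), (REG9)) are NOT printed ((9) has
`‖A‖_{1,β}` for `β ≤ β₀` with `B₄(β₀)` depending on `β₀`; (10) only `|∂*∂A|`, `|ΔA|`; [Balaban1985RegularSpaces] p. 83 «Such information is unavailable for the
second order derivatives») and lose `log M` at block edges for generic data (memo §1–§2, job j326303).
WHAT ([folklore]; 0 def, 0 sorry).  §1 `exists_cutoff_chart_cube`: the cut-off potential `χ·A₀` on `ℤ^{d+1}` (skew, supported in the cube, `‖·‖ ≤ b₀`,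
`‖∇·‖ ≤ b₁ + b₀∕M_w`, `exp = U^{u₀}` on the inner cube).  §2 **`exists_periodic_chart_of_cubeChart`**: the periodic chart (exactly the ∃-clause shape of `hchart`).
HONEST FRAMING (page 1): kinematics of OUR objects; the cube chart is a HYPOTHESIS ([B11] Thm 1 (9) TYPE, first-order letters); nothing of Bałaban's asserted; NE7 NOT
PROVED; spine 0∕9; finite T⁴ rung (B)+1 — NOT infinite volume, NOT mass gap, NOT `BetaPertH`, NOT Clay.  Continuum YM on T⁴ ⇐ BetaPertH ∧ nine spine estimates (0/9
proved); BetaPertH ⇐ (D1) ∧ (D4) ∧ CAP+tail; G-an2-4 gates asym, D1 and NE2/3/4.  No `sorry`; axioms ⊆ {propext, Classical.choice, Quot.sound}.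
-/

set_option autoImplicit false

open scoped BigOperators Matrix Matrix.Norms.L2Operator
open NormedSpace Finset

namespace Summit.QuantumFields.BalabanUV.T4Continuum.NE7CubeChartTorus

open Literature.MathematicalPhysics.QuantumFieldTheory.Balaban1983to89
open B7Prop1Explicit B7Prop2Explicit
open B4TorusKernel.MultiPeriod (torusSupNorm circAbs)
open T4AveragingDeficitWall (IsUnitaryCfg IsSkewDir vary)
open T4AveragingDeficitWallBoundary (IsPeriodicCfg)
open AveragingDeficitPeriodicCounting (IsPeriodicDir)
open AveragingDeficitTorusChart (periodic_smul_vec)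
open NE3EnergyShapes (IsUnitarySite)
open BlockAveragePushDirSplit (flat)
open NE7GradientCurrency (vary_flat_one_apply)
open SkeletonLattice (cmod cdiv smul_cdiv_add_cmod)
open NE7LatticeLandauMinimiser (cmod_add_zsmul)
open NE7AxialChartCube (abs_sub_le_supDist supDist_step_le profile_mem_unitInterval abs_profile_sub_profile_le)
open NE7AxialChartTorus (abs_cen_le emod_succ_dichotomy)

noncomputable section

variable {d : ℕ} {n : Type*} [Fintype n] [DecidableEq n]

/-! ## §1 The cut-off of a cube chart -/

set_option maxHeartbeats 400000 in
/-- **THE CUT-OFF CUBE CHART.**  Given a unitary site gauge `u₀` and a potential `A₀` with `U^{u₀}(p, μ) = e^{A₀(p, μ)}`, `A₀(p, μ)` skew, `‖A₀(p, μ)‖ ≤ b₀` for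
`|p − z|_∞ ≤ R′` and `‖A₀(p + e_τ, μ) − A₀(p, μ)‖ ≤ b₁` whenever both `p` and `p + e_τ` lie in that cube, and a collar width `1 ≤ M_w ≤ R′`: the field
`A = χ(|p − z|_∞)·A₀` (profile `χ(D) = max(0, min(1, (R′ − D)∕M_w))`) is skew everywhere, vanishes unless `|p − z|_∞ ≤ R′`, has `‖A‖ ≤ b₀` and
`‖A(p + e_τ, μ) − A(p, μ)‖ ≤ b₁ + b₀∕M_w` for ALL `p, μ, τ`, and `exp A(p, μ) = U^{u₀}(p, μ)` for `|p − z|_∞ ≤ R′ − M_w`. [folklore] -/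
theorem exists_cutoff_chart_cube {U : Site (d + 1) → Fin (d + 1) → (Matrix n n ℂ)ˣ}
    {u₀ : Site (d + 1) → (Matrix n n ℂ)ˣ} {A₀ : Site (d + 1) → Fin (d + 1) → Matrix n n ℂ} (z : Site (d + 1)) (R' Mw : ℕ) (hMw : 1 ≤ Mw)
    {b₀ b₁ : ℝ} (hb₀ : 0 ≤ b₀) (hb₁ : 0 ≤ b₁)
    (hUA : ∀ (p : Site (d + 1)) (μ : Fin (d + 1)), (∀ i, |p i - z i| ≤ (R' : ℤ)) → gaugeAct u₀ U p μ = expUnit (A₀ p μ))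
    (hskew : ∀ (p : Site (d + 1)) (μ : Fin (d + 1)), (∀ i, |p i - z i| ≤ (R' : ℤ)) → A₀ p μ ∈ skewAdjoint (Matrix n n ℂ))
    (hA0 : ∀ (p : Site (d + 1)) (μ : Fin (d + 1)), (∀ i, |p i - z i| ≤ (R' : ℤ)) → ‖A₀ p μ‖ ≤ b₀)
    (hA1 : ∀ (p : Site (d + 1)) (μ τ : Fin (d + 1)), (∀ i, |p i - z i| ≤ (R' : ℤ)) → (∀ i, |(p + e τ) i - z i| ≤ (R' : ℤ)) →
      ‖A₀ (p + e τ) μ - A₀ p μ‖ ≤ b₁) :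
    ∃ A : Site (d + 1) → Fin (d + 1) → Matrix n n ℂ,
      (∀ (p : Site (d + 1)) (μ : Fin (d + 1)), A p μ ∈ skewAdjoint (Matrix n n ℂ)) ∧
      (∀ (p : Site (d + 1)) (μ : Fin (d + 1)), (∃ i, (R' : ℤ) < |p i - z i|) → A p μ = 0) ∧
      (∀ (p : Site (d + 1)) (μ : Fin (d + 1)), ‖A p μ‖ ≤ b₀) ∧
      (∀ (p : Site (d + 1)) (μ τ : Fin (d + 1)), ‖A (p + e τ) μ - A p μ‖ ≤ b₁ + b₀ / Mw) ∧
      (∀ (p : Site (d + 1)) (μ : Fin (d + 1)), (∀ i, |p i - z i| ≤ (R' : ℤ) - Mw) →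
        exp (A p μ) = ((gaugeAct u₀ U p μ : (Matrix n n ℂ)ˣ) : Matrix n n ℂ)) := by
  set D : Site (d + 1) → ℤ := fun p => Finset.univ.sup' Finset.univ_nonempty (fun j => |p j - z j|) with hD
  set χ : Site (d + 1) → ℝ := fun p => max 0 (min 1 (((R' : ℝ) - (D p : ℝ)) / (Mw : ℝ))) with hχ
  have hMw0 : (0 : ℝ) < Mw := by exact_mod_cast hMw
  -- cube membership from the sup-distance
  have hDle : ∀ (p : Site (d + 1)) (c : ℤ), D p ≤ c → ∀ i, |p i - z i| ≤ c := fun p c h i => (abs_sub_le_supDist z p i).trans h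
  have hDge : ∀ (p : Site (d + 1)) (c : ℤ), (∀ i, |p i - z i| ≤ c) → D p ≤ c := fun p c h => Finset.sup'_le _ _ fun j _ => h j
  -- the profile
  have hχ01 : ∀ p, 0 ≤ χ p ∧ χ p ≤ 1 := fun p => profile_mem_unitInterval _ _ _
  have hχ1 : ∀ p : Site (d + 1), D p ≤ (R' : ℤ) - Mw → χ p = 1 := fun p hp => by
    have h1 : (1 : ℝ) ≤ ((R' : ℝ) - (D p : ℝ)) / (Mw : ℝ) := by
      rw [le_div_iff₀ hMw0, one_mul]
      have : ((D p : ℤ) : ℝ) ≤ ((R' : ℤ) : ℝ) - (Mw : ℝ) := by exact_mod_cast hp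
      push_cast at this; linarith
    rw [hχ]; simp only
    rw [min_eq_left h1, max_eq_right zero_le_one]
  have hχ0 : ∀ p : Site (d + 1), (R' : ℤ) ≤ D p → χ p = 0 := fun p hp => by
    have h1 : ((R' : ℝ) - (D p : ℝ)) / (Mw : ℝ) ≤ 0 := by
      apply div_nonpos_of_nonpos_of_nonneg _ hMw0.le
      have : ((R' : ℤ) : ℝ) ≤ ((D p : ℤ) : ℝ) := by exact_mod_cast hp
      push_cast at this; linarith
    rw [hχ]; simp only
    rw [max_eq_left (min_le_of_right_le h1)]
  have hχlip : ∀ (p : Site (d + 1)) (τ : Fin (d + 1)), |χ (p + e τ) - χ p| ≤ 1 / Mw := fun p τ => by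
    have h := abs_profile_sub_profile_le hMw0 (R' : ℝ) (D (p + e τ) : ℝ) (D p : ℝ)
    refine h.trans (div_le_div_of_nonneg_right ?_ hMw0.le)
    have h1 := supDist_step_le z p τ
    rw [abs_le]
    constructor
    · have : ((D p : ℤ) : ℝ) ≤ ((D (p + e τ) : ℤ) : ℝ) + 1 := by exact_mod_cast h1.2
      linarith
    · have : ((D (p + e τ) : ℤ) : ℝ) ≤ ((D p : ℤ) : ℝ) + 1 := by exact_mod_cast h1.1
      linarith
  -- THE FIELD
  refine ⟨fun p μ => χ p • A₀ p μ, ?_, ?_, ?_, ?_, ?_⟩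
  · -- skew
    intro p μ
    by_cases hp : D p < (R' : ℤ)
    · exact skewAdjoint.smul_mem _ (hskew p μ (hDle p _ hp.le))
    · have h0 : χ p = 0 := hχ0 p (by push Not at hp; exact hp)
      simp only [h0, zero_smul]
      exact (skewAdjoint (Matrix n n ℂ)).zero_mem
  · -- support
    rintro p μ ⟨i, hi⟩
    have hDp : (R' : ℤ) ≤ D p := hi.le.trans (abs_sub_le_supDist z p i)
    simp only [hχ0 p hDp, zero_smul]
  · -- sup
    intro p μ
    by_cases hp : D p < (R' : ℤ)
    · calc ‖χ p • A₀ p μ‖ = |χ p| * ‖A₀ p μ‖ := norm_smul _ _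
        _ ≤ 1 * b₀ := mul_le_mul (by rw [abs_of_nonneg (hχ01 p).1]; exact (hχ01 p).2) (hA0 p μ (hDle p _ hp.le)) (norm_nonneg _) zero_le_one
        _ = b₀ := one_mul _
    · have h0 : χ p = 0 := hχ0 p (by push Not at hp; exact hp)
      simp only [h0, zero_smul, norm_zero]
      exact hb₀
  · -- gradient
    intro p μ τ
    have hb₀M : 0 ≤ b₀ / Mw := by positivity
    by_cases hq : D (p + e τ) < (R' : ℤ)
    · -- `p + e τ` is strictly inside: both points lie in the closed cube
      have hp : D p ≤ (R' : ℤ) := by have := (supDist_step_le z p τ).2; linarith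
      have hsplit : χ (p + e τ) • A₀ (p + e τ) μ - χ p • A₀ p μ
          = χ (p + e τ) • (A₀ (p + e τ) μ - A₀ p μ) + (χ (p + e τ) - χ p) • A₀ p μ := by
        rw [smul_sub, sub_smul]; abel
      rw [hsplit]
      calc _ ≤ ‖χ (p + e τ) • (A₀ (p + e τ) μ - A₀ p μ)‖ + ‖(χ (p + e τ) - χ p) • A₀ p μ‖ := norm_add_le _ _
        _ = |χ (p + e τ)| * ‖A₀ (p + e τ) μ - A₀ p μ‖ + |χ (p + e τ) - χ p| * ‖A₀ p μ‖ := by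
            rw [norm_smul, norm_smul, Real.norm_eq_abs, Real.norm_eq_abs]
        _ ≤ 1 * b₁ + (1 / Mw) * b₀ :=
            add_le_add (mul_le_mul (by rw [abs_of_nonneg (hχ01 _).1]; exact (hχ01 _).2) (hA1 p μ τ (hDle p _ hp) (hDle _ _ hq.le)) (norm_nonneg _) zero_le_one)
              (mul_le_mul (hχlip p τ) (hA0 p μ (hDle p _ hp)) (norm_nonneg _) (by positivity))
        _ = b₁ + b₀ / Mw := by ring
    · -- `p + e τ` is outside the open cube: its coefficient vanishes
      push Not at hq
      have h0' : χ (p + e τ) = 0 := hχ0 (p + e τ) hq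
      by_cases hp : D p < (R' : ℤ)
      · have h1 : |χ p| ≤ 1 / Mw := by
          have h := hχlip p τ
          rwa [h0', zero_sub, abs_neg] at h
        simp only [h0', zero_smul, zero_sub, norm_neg]
        calc ‖χ p • A₀ p μ‖ = |χ p| * ‖A₀ p μ‖ := norm_smul _ _
          _ ≤ (1 / Mw) * b₀ := mul_le_mul h1 (hA0 p μ (hDle p _ hp.le)) (norm_nonneg _) (by positivity)
          _ = b₀ / Mw := by ring
          _ ≤ b₁ + b₀ / Mw := by linarith
      · have h0 : χ p = 0 := hχ0 p (by push Not at hp; exact hp)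
        simp only [h0, h0', zero_smul, sub_zero, norm_zero]
        positivity
  · -- exp on the inner cube
    intro p μ hp
    have hDp : D p ≤ (R' : ℤ) - Mw := hDge p _ hp
    have hMw' : (0 : ℤ) ≤ Mw := by positivity
    have hp1 : ∀ i, |p i - z i| ≤ (R' : ℤ) := hDle p _ (hDp.trans (by linarith))
    simp only [hχ1 p hDp, one_smul]
    rw [hUA p μ hp1, val_expUnit]

/-! ## §2 The periodic chart -/

set_option maxHeartbeats 800000 in
/-- **THE PERIODIC CHART FROM A CUBE CHART** (the ∃-clause shape of the wide chain's `hchart`).  For a unitary `P`-periodic `U` on `ℤ^{d+1}`, a centre `z`, radii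
`1 ≤ M_w ≤ R′` with `2R′ + 4 ≤ P`, and a cube chart about `z` — a unitary site gauge `u₀` and a potential `A₀` with `U^{u₀}(p, μ) = e^{A₀(p, μ)}`, `A₀(p, μ)` skew and
`‖A₀(p, μ)‖ ≤ b₀` for `|p − z|_∞ ≤ R′`, `‖A₀(p + e_τ, μ) − A₀(p, μ)‖ ≤ b₁` when both points lie in that cube ([Balaban1985Variational] Thm 1 (9) TYPE, first-order
letters): there are a unitary `P`-periodic site gauge `u` and a skew `P`-periodic `At` with `‖At(y, κ)‖ ≤ b₀`, `‖At(y + e_τ, κ) − At(y, κ)‖ ≤ b₁ + b₀∕M_w` for ALL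
`y, κ, τ`, and `U^{u}(y, κ) = (vary flat At 1)(y, κ)` whenever `torusSupNorm (y − z) ≤ R′ − M_w`. [folklore] -/
theorem exists_periodic_chart_of_cubeChart {U : Site (d + 1) → Fin (d + 1) → (Matrix n n ℂ)ˣ} {P : ℕ}
    (hUP : IsPeriodicCfg U (P : ℤ)) (z : Site (d + 1)) (R' Mw : ℕ) (hMw : 1 ≤ Mw) (hMwR : Mw ≤ R') (hPR : 2 * R' + 4 ≤ P)
    {u₀ : Site (d + 1) → (Matrix n n ℂ)ˣ} (hu₀ : IsUnitarySite u₀) {A₀ : Site (d + 1) → Fin (d + 1) → Matrix n n ℂ}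
    {b₀ b₁ : ℝ} (hb₀ : 0 ≤ b₀) (hb₁ : 0 ≤ b₁)
    (hUA : ∀ (p : Site (d + 1)) (μ : Fin (d + 1)), (∀ i, |p i - z i| ≤ (R' : ℤ)) → gaugeAct u₀ U p μ = expUnit (A₀ p μ))
    (hskew : ∀ (p : Site (d + 1)) (μ : Fin (d + 1)), (∀ i, |p i - z i| ≤ (R' : ℤ)) → A₀ p μ ∈ skewAdjoint (Matrix n n ℂ))
    (hA0 : ∀ (p : Site (d + 1)) (μ : Fin (d + 1)), (∀ i, |p i - z i| ≤ (R' : ℤ)) → ‖A₀ p μ‖ ≤ b₀)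
    (hA1 : ∀ (p : Site (d + 1)) (μ τ : Fin (d + 1)), (∀ i, |p i - z i| ≤ (R' : ℤ)) → (∀ i, |(p + e τ) i - z i| ≤ (R' : ℤ)) →
      ‖A₀ (p + e τ) μ - A₀ p μ‖ ≤ b₁) :
    ∃ (u : Site (d + 1) → (Matrix n n ℂ)ˣ) (At : Site (d + 1) → Fin (d + 1) → Matrix n n ℂ),
      IsUnitarySite u ∧ (∀ (y : Site (d + 1)) (i : Fin (d + 1)), u (y + (P : ℤ) • e i) = u y) ∧
      IsSkewDir At ∧ IsPeriodicDir At (P : ℤ) ∧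
      (∀ (y : Site (d + 1)) (κ : Fin (d + 1)), ‖At y κ‖ ≤ b₀) ∧
      (∀ (y : Site (d + 1)) (κ τ : Fin (d + 1)), ‖At (y + e τ) κ - At y κ‖ ≤ b₁ + b₀ / Mw) ∧
      (∀ (y : Site (d + 1)) (κ : Fin (d + 1)), torusSupNorm (fun _ : Fin (d + 1) => P) (y - z) ≤ ((R' - Mw : ℕ) : ℝ) →
        gaugeAct u U y κ = vary (flat (d := d + 1) (n := n)) At 1 y κ) := by
  -- the cut-off cube chart
  obtain ⟨A, hAskew, hAsupp, hAsup, hAgrad, hAexp⟩ := exists_cutoff_chart_cube (U := U) z R' Mw hMw hb₀ hb₁ hUA hskew hA0 hA1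
  -- the centred representative `c y = z − h𝟙 + ((y − z + h𝟙) mod P)`, `h = R′ + 1`
  have hP1 : 1 ≤ P := by omega
  have hP2 : 2 ≤ P := by omega
  set h : ℕ := R' + 1 with hh
  set hv : Site (d + 1) := fun _ => (h : ℤ) with hhv
  set c : Site (d + 1) → Site (d + 1) := fun y => cmod P (y - z + hv) + (z - hv) with hc
  have hc_apply : ∀ (y : Site (d + 1)) (j : Fin (d + 1)), c y j = (y j - z j + (h : ℤ)) % (P : ℤ) + (z j - (h : ℤ)) := fun y j => rfl
  -- periodicity of the representative
  have hc_per : ∀ (y : Site (d + 1)) (i : Fin (d + 1)), c (y + (P : ℤ) • e i) = c y := fun y i => by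
    simp only [hc]
    rw [show y + (P : ℤ) • e i - z + hv = (y - z + hv) + (P : ℤ) • e i by abel, cmod_add_zsmul hP1]
  -- congruence: `c y = y + P • m`
  have hc_cong : ∀ y : Site (d + 1), c y = y + (P : ℤ) • (-cdiv P (y - z + hv)) := fun y => by
    have h1 := smul_cdiv_add_cmod P (y - z + hv)
    simp only [hc]
    rw [smul_neg, ← sub_eq_add_neg, eq_sub_iff_add_eq]
    calc cmod P (y - z + hv) + (z - hv) + (P : ℤ) • cdiv P (y - z + hv) = ((P : ℤ) • cdiv P (y - z + hv) + cmod P (y - z + hv)) + (z - hv) := by abel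
      _ = y := by rw [h1]; abel
  have hU_c : ∀ (y : Site (d + 1)) (κ : Fin (d + 1)), U (c y) κ = U y κ := fun y κ => by
    rw [hc_cong y]
    exact congrFun (periodic_smul_vec (f := fun w => U w) (N := (P : ℤ)) (fun w i => funext fun μ => hUP w i μ) y _) κ
  -- on the ball the representative is centred and does not meet the seam
  have hball : ∀ y : Site (d + 1), torusSupNorm (fun _ : Fin (d + 1) => P) (y - z) ≤ ((R' - Mw : ℕ) : ℝ) →
      ∀ j, |c y j - z j| ≤ (R' : ℤ) - Mw := fun y hy j => by
    have h1 : (circAbs P ((y - z) j) : ℝ) ≤ ((R' - Mw : ℕ) : ℝ) := by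
      refine le_trans ?_ hy
      unfold torusSupNorm
      exact Finset.le_sup' (fun i => ((circAbs P ((y - z) i) : ℤ) : ℝ)) (Finset.mem_univ j)
    have h2 : circAbs P ((y - z) j) ≤ ((R' - Mw : ℕ) : ℤ) := by exact_mod_cast h1
    have h3 := abs_cen_le hP1 (Rb := R' - Mw) (h := h) (by omega) (by omega) ((y - z) j) h2
    rw [hc_apply, show (y j - z j + (h : ℤ)) % (P : ℤ) + (z j - (h : ℤ)) - z j = (y j - z j + (h : ℤ)) % (P : ℤ) - (h : ℤ) by ring]
    have h4 : ((R' - Mw : ℕ) : ℤ) = (R' : ℤ) - Mw := by push_cast [Nat.cast_sub hMwR]; ring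
    rw [← h4]
    simpa [Pi.sub_apply] using h3
  have hstep : ∀ (y : Site (d + 1)) (τ : Fin (d + 1)),
      c (y + e τ) = c y + e τ ∨ ((R' : ℤ) < |c y τ - z τ| ∧ (R' : ℤ) < |c (y + e τ) τ - z τ|) := fun y τ => by
    rcases emod_succ_dichotomy hP2 (y τ - z τ) (h : ℤ) with ⟨_, hr2⟩ | ⟨hr1, hr2⟩
    · left
      funext j
      rw [Pi.add_apply, hc_apply, hc_apply, Pi.add_apply, e_apply]
      split_ifs with hj
      · rw [hj, show y τ + 1 - z τ + (h : ℤ) = y τ - z τ + 1 + (h : ℤ) by ring, hr2]; ring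
      · simp
    · right
      have hP' : ((2 * R' + 4 : ℕ) : ℤ) ≤ (P : ℤ) := by exact_mod_cast hPR
      push_cast at hP'
      constructor
      · rw [hc_apply, hr1, show (P : ℤ) - 1 + (z τ - (h : ℤ)) - z τ = (P : ℤ) - 1 - (h : ℤ) by ring, hh]
        push_cast
        rw [abs_of_nonneg (by linarith)]
        linarith
      · rw [hc_apply, Pi.add_apply, e_apply, if_pos rfl, show y τ + 1 - z τ + (h : ℤ) = y τ - z τ + 1 + (h : ℤ) by ring, hr2, hh]
        push_cast
        rw [show (0 : ℤ) + (z τ - ((R' : ℤ) + 1)) - z τ = -((R' : ℤ) + 1) by ring, abs_neg, abs_of_nonneg (by positivity)]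
        linarith
  -- the gauge and the potential
  refine ⟨fun y => u₀ (c y), fun y κ => A (c y) κ, ?_, ?_, ?_, ?_, ?_, ?_, ?_⟩
  · -- unitary
    intro y
    exact hu₀ _
  · -- periodic gauge
    intro y i
    simp only [hc_per]
  · -- skew
    intro y κ
    exact hAskew _ _
  · -- periodic potential
    intro y i μ
    simp only [hc_per]
  · -- sup
    intro y κ
    exact hAsup _ _
  · -- gradient
    intro y κ τ
    rcases hstep y τ with h1 | ⟨h1, h2⟩
    · simp only [h1]
      exact hAgrad _ _ _
    · have e1 : A (c y) κ = 0 := hAsupp _ _ ⟨τ, h1⟩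
      have e2 : A (c (y + e τ)) κ = 0 := hAsupp _ _ ⟨τ, h2⟩
      simp only [e1, e2, sub_zero, norm_zero]
      positivity
  · -- agreement on the ball
    intro y κ hy
    have hyb := hball y hy
    have hstep' : c (y + e κ) = c y + e κ := by
      rcases hstep y κ with h1 | ⟨h1, _⟩
      · exact h1
      · exfalso
        have := hyb κ
        have hMw' : (0 : ℤ) ≤ Mw := by positivity
        linarith
    apply Units.ext
    rw [vary_flat_one_apply, val_expUnit, hAexp (c y) κ hyb]
    simp only [gaugeAct, hstep', hU_c]

end

end Summit.QuantumFields.BalabanUV.T4Continuum.NE7CubeChartTorus
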